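import Literature.Combinatorics.SimpleGraph.HamiltonianLOTLayout
import Literature.Computability.Complexity.CodeFPArithExpr
import Literature.Computability.Complexity.CodeFPListKit
import Literature.Computability.Complexity.CodeFPLists
import Literature.Barriers.CriticalPhenomena.GridSAWGadgetsFromDrawnFamily
import Literature.Barriers.CriticalPhenomena.GridSAWTiledDrawingData
import Literature.Barriers.CriticalPhenomena.GridSAWGridFormulaCellsFP
import HarnessLib

/-!
# The profile of a formula and the layout quantities, in typed polynomial time

Support for the machine half of `GridSAW.LOT2003_lemma4_gadgets` (Liśkiewicz–Ogihara–Toda 2003,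
Lemma 4: "It is not hard to see that `R` is polynomial-time computable") for the construction
`HamiltonianLOTLayout.lean` / `GridSAWLOTDrawing.lean`. Everything the drawing of the gadget graph
of `φ` depends on is a function of a small PROFILE of `φ` — the number of cells `N`, the table of
previous occurrences (`LOTReduction.prev?`, coded `0 / r + 1`) and the table of polarities — and of
an index; the layout quantities (`M`, `base1`, `dlBase`, `base2`, `J`, `IsTap`, …) are values of
fixed arithmetic expressions (`CodeFP.AExp`, `CodeFPArithExpr.lean`) in the environment
`env φ i = ([N, i], [prevCodes, polsN])`. This file computes the profile in typed polynomial time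
from the code `cnfC` of `φ` (`codeFP_env`) and lists the expressions with their evaluation lemmas.

* `vars`, `polsN`, `prevCode`, `prevCodes`, `env`; `codeFP_cells`, `gridN_eq` (so that
  `GridFormulaFP.codeFP_uN` / `codeFP_N` serve), `codeFP_vars`, `codeFP_polsN`, `prevCodeL`, `codeFP_prevCodeL`, **`codeFP_prevCodes`**,
  **`codeFP_env`**;
* the expressions `eN, eIdx, eT, eM, eBase1, eNN, eDlBase, ePinBase, eClause1Base, eOr3Base,
  eBase2, eSetBase, eKlinkBase, eTotalV, eKIdx, eZIdx, eBlIdx, eJ, ePrev, eTap, eIsSome, eIsNone,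
  ePol` and their values in `env φ i` (`ev_*`, `flag_*`).

## References

* M. Liśkiewicz, M. Ogihara, S. Toda, TCS 304 (2003) 129–156, §3 (proof of Lemma 4).
* S. Arora, B. Barak, *Computational Complexity: A Modern Approach*, CUP 2009, §1.3.
-/

namespace Literature.Barriers.CriticalPhenomena.GridSAW

namespace LOTProfile

open _root_.Computability Literature.Computability.Complexity Literature.Computability.Complexity.CodeFP
open Literature.Combinatorics.SimpleGraph Literature.Combinatorics.SimpleGraph.LOTReduction

variable (φ : CNF ℕ)

/-! ### The profile -/

/-- The variables of the cells. [folklore] -/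
def vars : List ℕ := (FormulaCells.cells φ).map Prod.fst

/-- The polarities of the cells, as `1 / 0`. [folklore] -/
def polsN : List ℕ := (FormulaCells.cells φ).map fun l => if l.2 then 1 else 0

/-- Options coded by naturals: `none ↦ 0`, `some r ↦ r + 1`. [folklore] -/
def optCode : Option ℕ → ℕ
  | none => 0
  | some r => r + 1

/-- The coded previous occurrence of the variable of cell `c`. [folklore] -/
def prevCode (c : ℕ) : ℕ := optCode (prev? φ c)

/-- The table of coded previous occurrences. [folklore] -/
def prevCodes : List ℕ := (List.range (N φ)).map (prevCode φ)

/-- **The environment of index `i`**: scalars `[N, i]`, tables `[prevCodes, polsN]`. [folklore] -/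
def env (i : ℕ) : AEnv := ([N φ, i], [prevCodes φ, polsN φ])

variable {φ}

/-- The table of variables. [folklore] -/
theorem vars_getD (c : ℕ) : (vars φ).getD c 0 = FormulaCells.varOf φ c := by
  unfold vars FormulaCells.varOf
  exact List.getD_map (l := FormulaCells.cells φ) (n := c) (d := ((0 : ℕ), false)) Prod.fst

/-- The table of polarities. [folklore] -/
theorem polsN_getD (c : ℕ) : (polsN φ).getD c 0 = if FormulaCells.polOf φ c then 1 else 0 := by
  unfold polsN FormulaCells.polOf
  exact List.getD_map (l := FormulaCells.cells φ) (n := c) (d := ((0 : ℕ), false)) (fun l : Literal ℕ => if l.2 then 1 else 0)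

/-- The table of previous occurrences. [folklore] -/
theorem prevCodes_getD {c : ℕ} (hc : c < N φ) : (prevCodes φ).getD c 0 = prevCode φ c := PData.getD_map_range _ hc _

/-- `prev? c = some r` in terms of the code. [folklore] -/
theorem prevCode_eq_succ_iff {c r : ℕ} : prevCode φ c = r + 1 ↔ prev? φ c = some r := by
  unfold prevCode; cases prev? φ c <;> simp [optCode]

/-- `(prev? c).isSome` in terms of the code. [folklore] -/
theorem prevCode_pos_iff {c : ℕ} : 0 < prevCode φ c ↔ (prev? φ c).isSome = true := by
  unfold prevCode; cases prev? φ c <;> simp [optCode]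

/-! ### The profile in typed polynomial time -/

/-- The cells (`φ.flatten`, raw list of literals). [cite: AroraBarak2009, §1.3] -/
theorem codeFP_cells : CodeFP cnfC (rawE litC) FormulaCells.cells :=
  (((flatten litC).comp (map₀ (rawOfList litC))).comp (rawOfList clauseC)).congr fun ψ => by
    simp [FormulaCells.cells]

/-- The number of cells is the number of columns of `GridFormulaCells.lean` (both `|φ.flatten|`), so
that `GridFormulaFP.codeFP_uN` / `codeFP_N` serve. [folklore] -/
theorem gridN_eq : ∀ φ : CNF ℕ, GridFormula.N φ = N φ := fun _ => rfl

/-- The table of variables. [cite: AroraBarak2009, §1.3] -/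
theorem codeFP_vars : CodeFP cnfC (rawE natE) vars := ((map₀ (fst natE bitE)).comp codeFP_cells).congr fun _ => rfl

/-- The table of polarities. [cite: AroraBarak2009, §1.3] -/
theorem codeFP_polsN : CodeFP cnfC (rawE natE) polsN :=
  ((map₀ (ite (snd natE bitE) (const _ 1) (const _ 0))).comp codeFP_cells).congr fun _ => rfl

/-- The coded previous occurrence, from the table of variables: the last `d < n` with the variable
of `c`. [folklore] -/
def prevCodeL (vs : List ℕ) (n c : ℕ) : ℕ :=
  optCode ((List.range n).filter fun d => vs.getD d 0 == vs.getD c 0).getLast?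

/-- `prevCodeL` on the profile is `prevCode`. [folklore] -/
theorem prevCodeL_eq (c : ℕ) : prevCodeL (vars φ) c c = prevCode φ c := by
  unfold prevCodeL prevCode prev?
  congr 2
  exact List.filter_congr fun d _ => by rw [vars_getD, vars_getD]; exact Bool.beq_eq_decide_eq _ _

/-- **`prevCodeL` is typed polynomial time** (context: a unary budget for the range and the table;
item: the cell). [cite: AroraBarak2009, §1.3] -/
theorem codeFP_prevCodeL : CodeFP (pairE (pairE unE (rawE natE)) natE) natE (fun q => prevCodeL q.1.2 (min q.2 q.1.1) q.2) := by
  -- the range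
  have hrange : CodeFP (pairE (pairE unE (rawE natE)) natE) (rawE natE) (fun q => List.range (min q.2 q.1.1)) :=
    rangeOf.comp ((fst _ _).fst'.pair (snd _ _))
  -- the filter, with context (table, cell)
  have hp : CodeFP (pairE (pairE (rawE natE) natE) natE) bitE (fun t => t.1.1.getD t.2 0 == t.1.1.getD t.1.2 0) :=
    (beq natE_injective).comp (((rawGetD natE (d := 0) rfl).comp ((fst _ _).fst'.pair (snd _ _))).pair
      ((rawGetD natE (d := 0) rfl).comp ((fst _ _).fst'.pair (fst _ _).snd')))
  have hctx : CodeFP (pairE (pairE unE (rawE natE)) natE) (pairE (rawE natE) natE) (fun q => (q.1.2, q.2)) :=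
    (fst _ _).snd'.pair (snd _ _)
  have hfilt : CodeFP (pairE (pairE unE (rawE natE)) natE) (rawE natE)
      (fun q => (List.range (min q.2 q.1.1)).filter fun d => q.1.2.getD d 0 == q.1.2.getD q.2 0) :=
    ((filter hp).comp (hctx.pair hrange)).congr fun _ => rfl
  have hlast : CodeFP (pairE (pairE unE (rawE natE)) natE) (optE natE)
      (fun q => ((List.range (min q.2 q.1.1)).filter fun d => q.1.2.getD d 0 == q.1.2.getD q.2 0).getLast?) :=
    (((rawHead? natE).comp (rawReverse natE)).comp hfilt).congr fun _ => by simp [List.head?_reverse]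
  have hcode : CodeFP (pairE unE (optE natE)) natE (fun t => optCode t.2) :=
    optCases (k := fun (_ : ℕ) (o : Option ℕ) => optCode o) (gnone := fun _ => 0) (gsome := fun t => t.2 + 1)
      (const _ 0) (natAdd.comp ((snd _ _).pair (const _ 1))) (fun _ => rfl) (fun _ _ => rfl)
  exact (hcode.comp ((fst _ _).fst'.pair hlast)).congr fun _ => rfl

/-- **The table of previous occurrences is typed polynomial time.** [cite: AroraBarak2009, §1.3] -/
theorem codeFP_prevCodes : CodeFP cnfC (rawE natE) prevCodes := by
  have huN : CodeFP cnfC unE N := GridFormulaFP.codeFP_uN.congr gridN_eq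
  have hctx : CodeFP cnfC (pairE unE (rawE natE)) (fun ψ => (N ψ, vars ψ)) := huN.pair codeFP_vars
  have hrange : CodeFP cnfC (rawE natE) (fun ψ => List.range (N ψ)) := urange.comp huN
  have h := (map codeFP_prevCodeL).comp (hctx.pair hrange)
  refine h.congr fun ψ => ?_
  unfold prevCodes
  refine List.map_congr_left fun c hc => ?_
  rw [List.mem_range] at hc
  dsimp only
  rw [min_eq_left hc.le, prevCodeL_eq]

/-- **The environment of index `i` is typed polynomial time** in the code of `φ` and `i`. [cite: AroraBarak2009, §1.3] -/
theorem codeFP_env : CodeFP (pairE cnfC natE) aenvE (fun p => env p.1 p.2) := by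
  have hbN : CodeFP cnfC natE N := GridFormulaFP.codeFP_N.congr gridN_eq
  have hN : CodeFP (pairE cnfC natE) natE (fun p => N p.1) := hbN.comp (fst _ _)
  have hi : CodeFP (pairE cnfC natE) natE (fun p => p.2) := snd _ _
  have hpc : CodeFP (pairE cnfC natE) (rawE natE) (fun p => prevCodes p.1) := codeFP_prevCodes.comp (fst _ _)
  have hpo : CodeFP (pairE cnfC natE) (rawE natE) (fun p => polsN p.1) := codeFP_polsN.comp (fst _ _)
  exact (codeFP_mkEnv (codeFP_consNat hN (codeFP_consNat hi (const _ []))) (codeFP_consTbl hpc (codeFP_consTbl hpo (const _ [])))).congr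
    fun _ => rfl

/-! ### The layout quantities as expressions -/

/-- `N`. [folklore] -/
def eN : AExp := .var 0
/-- The index. [folklore] -/
def eIdx : AExp := .var 1
/-- `T = (N - 1) / 3`. [folklore] -/
def eT : AExp := .div (.sub eN (.lit 1)) (.lit 3)
/-- `M = 2N + N(2N+1) + N + 1`. [folklore] -/
def eM : AExp := .add (.add (.add (.mul (.lit 2) eN) (.mul eN (.add (.mul (.lit 2) eN) (.lit 1)))) eN) (.lit 1)
/-- `base1 = 5M`. [folklore] -/
def eBase1 : AExp := .mul (.lit 5) eM
/-- `N²`. [folklore] -/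
def eNN : AExp := .mul eN eN
/-- `dlBase r s = base1 + 24 (r N + s)`. [folklore] -/
def eDlBase (r s : AExp) : AExp := .add eBase1 (.mul (.lit 24) (.add (.mul r eN) s))
/-- `pinBase k = base1 + 24 N² + 3 k`. [folklore] -/
def ePinBase (k : AExp) : AExp := .add (.add eBase1 (.mul (.lit 24) eNN)) (.mul (.lit 3) k)
/-- `clause1Base = base1 + 24 N² + 6 N`. [folklore] -/
def eClause1Base : AExp := .add (.add eBase1 (.mul (.lit 24) eNN)) (.mul (.lit 6) eN)
/-- `or3Base t = clause1Base + 3 + 27 t`. [folklore] -/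
def eOr3Base (t : AExp) : AExp := .add (.add eClause1Base (.lit 3)) (.mul (.lit 27) t)
/-- `base2 = clause1Base + 3 + 27 T`. [folklore] -/
def eBase2 : AExp := .add (.add eClause1Base (.lit 3)) (.mul (.lit 27) eT)
/-- `setBase c = base2 + 60 N² + 12 c`. [folklore] -/
def eSetBase (c : AExp) : AExp := .add (.add eBase2 (.mul (.lit 60) eNN)) (.mul (.lit 12) c)
/-- `klinkBase c = base2 + 60 N² + 12 N + 12 c`. [folklore] -/
def eKlinkBase (c : AExp) : AExp := .add (.add (.add eBase2 (.mul (.lit 60) eNN)) (.mul (.lit 12) eN)) (.mul (.lit 12) c)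
/-- `totalV = base2 + 60 N² + 24 N`. [folklore] -/
def eTotalV : AExp := .add (.add eBase2 (.mul (.lit 60) eNN)) (.mul (.lit 24) eN)
/-- `kIdx c = 2N + N(2N+1) + c`. [folklore] -/
def eKIdx (c : AExp) : AExp := .add (.add (.mul (.lit 2) eN) (.mul eN (.add (.mul (.lit 2) eN) (.lit 1)))) c
/-- `zIdx = kIdx N`. [folklore] -/
def eZIdx : AExp := eKIdx eN
/-- `blIdx r j = 2N + r (2N+1) + 2 j`. [folklore] -/
def eBlIdx (r j : AExp) : AExp := .add (.add (.mul (.lit 2) eN) (.mul r (.add (.mul (.lit 2) eN) (.lit 1)))) (.mul (.lit 2) j)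
/-- `J r c = if r odd then c else N - 1 - c`. [folklore] -/
def eJ (r c : AExp) : AExp := .cond (.emod r (.lit 2)) c (.sub (.sub eN (.lit 1)) c)
/-- The coded previous occurrence of cell `c`. [folklore] -/
def ePrev (c : AExp) : AExp := .tbl 0 c
/-- `IsTap r c` as `1 / 0`. [folklore] -/
def eTap (r c : AExp) : AExp := .cond (.beq r c) (.lit 1) (.beq (ePrev c) (.add r (.lit 1)))
/-- `(prev? c).isSome` as `1 / 0`. [folklore] -/
def eIsSome (c : AExp) : AExp := .lt (.lit 0) (ePrev c)
/-- `(prev? c).isNone` as `1 / 0`. [folklore] -/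
def eIsNone (c : AExp) : AExp := .beq (ePrev c) (.lit 0)
/-- The polarity of cell `c` as `1 / 0`. [folklore] -/
def ePol (c : AExp) : AExp := .tbl 1 c

section eval

variable {i : ℕ}

/-- `N`. [folklore] -/
@[simp] theorem ev_N : eN.eval (env φ i) = N φ := rfl
/-- The index. [folklore] -/
@[simp] theorem ev_Idx : eIdx.eval (env φ i) = i := rfl
/-- Table `0` is `prevCodes`. [folklore] -/
@[simp] theorem ev_tbl0 (e : AExp) : (AExp.tbl 0 e).eval (env φ i) = (prevCodes φ).getD (e.eval (env φ i)) 0 := rfl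
/-- Table `1` is `polsN`. [folklore] -/
@[simp] theorem ev_tbl1 (e : AExp) : (AExp.tbl 1 e).eval (env φ i) = (polsN φ).getD (e.eval (env φ i)) 0 := rfl
/-- `T`. [folklore] -/
@[simp] theorem ev_T : eT.eval (env φ i) = T φ := rfl
/-- `M`. [folklore] -/
@[simp] theorem ev_M : eM.eval (env φ i) = M φ := by simp [eM, M]
/-- `base1`. [folklore] -/
@[simp] theorem ev_base1 : eBase1.eval (env φ i) = base1 φ := by simp [eBase1, base1]
/-- `N²`. [folklore] -/
@[simp] theorem ev_NN : eNN.eval (env φ i) = N φ * N φ := by simp [eNN]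
/-- `dlBase`. [folklore] -/
@[simp] theorem ev_dlBase (r s : AExp) : (eDlBase r s).eval (env φ i) = dlBase φ (r.eval (env φ i)) (s.eval (env φ i)) := by
  simp [eDlBase, dlBase]
/-- `pinBase`. [folklore] -/
@[simp] theorem ev_pinBase (k : AExp) : (ePinBase k).eval (env φ i) = pinBase φ (k.eval (env φ i)) := by simp [ePinBase, pinBase]
/-- `clause1Base`. [folklore] -/
@[simp] theorem ev_clause1Base : eClause1Base.eval (env φ i) = clause1Base φ := by simp [eClause1Base, clause1Base]
/-- `or3Base`. [folklore] -/
@[simp] theorem ev_or3Base (t : AExp) : (eOr3Base t).eval (env φ i) = or3Base φ (t.eval (env φ i)) := by simp [eOr3Base, or3Base]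
/-- `base2`. [folklore] -/
@[simp] theorem ev_base2 : eBase2.eval (env φ i) = base2 φ := by simp [eBase2, base2]
/-- `setBase`. [folklore] -/
@[simp] theorem ev_setBase (c : AExp) : (eSetBase c).eval (env φ i) = setBase φ (c.eval (env φ i)) := by simp [eSetBase, setBase]
/-- `klinkBase`. [folklore] -/
@[simp] theorem ev_klinkBase (c : AExp) : (eKlinkBase c).eval (env φ i) = klinkBase φ (c.eval (env φ i)) := by
  simp [eKlinkBase, klinkBase]
/-- `totalV`. [folklore] -/
@[simp] theorem ev_totalV : eTotalV.eval (env φ i) = totalV φ := by simp [eTotalV, totalV]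
/-- `kIdx`. [folklore] -/
@[simp] theorem ev_kIdx (c : AExp) : (eKIdx c).eval (env φ i) = kIdx φ (c.eval (env φ i)) := by simp [eKIdx, kIdx]
/-- `zIdx`. [folklore] -/
@[simp] theorem ev_zIdx : eZIdx.eval (env φ i) = zIdx φ := by simp [eZIdx, zIdx, kIdx]
/-- `blIdx`. [folklore] -/
@[simp] theorem ev_blIdx (r j : AExp) : (eBlIdx r j).eval (env φ i) = blIdx φ (r.eval (env φ i)) (j.eval (env φ i)) := by
  simp [eBlIdx, blIdx, rowCell, rowStart]
/-- `J`. [folklore] -/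
@[simp] theorem ev_J (r c : AExp) : (eJ r c).eval (env φ i) = J φ (r.eval (env φ i)) (c.eval (env φ i)) := by
  simp only [eJ, AExp.eval_cond, AExp.eval_emod, AExp.eval_lit, AExp.eval_sub, ev_N]
  unfold J
  by_cases h : r.eval (env φ i) % 2 = 1
  · rw [if_pos h, if_neg (by omega)]
  · rw [if_neg h, if_pos (by omega)]
/-- The coded previous occurrence. [folklore] -/
theorem ev_prev {c : AExp} (hc : c.eval (env φ i) < N φ) : (ePrev c).eval (env φ i) = prevCode φ (c.eval (env φ i)) := by
  simp only [ePrev, ev_tbl0]; exact prevCodes_getD hc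
/-- The tap flag. [folklore] -/
theorem flag_tap {r c : AExp} (hc : c.eval (env φ i) < N φ) :
    (eTap r c).flag (env φ i) = decide (IsTap φ (r.eval (env φ i)) (c.eval (env φ i))) := by
  unfold AExp.flag IsTap
  simp only [eTap, AExp.eval_cond, AExp.eval_beq, AExp.eval_lit, AExp.eval_add, ev_prev hc]
  by_cases h1 : r.eval (env φ i) = c.eval (env φ i)
  · simp [h1]
  · rw [if_neg h1]
    by_cases h2 : prevCode φ (c.eval (env φ i)) = r.eval (env φ i) + 1
    · have := prevCode_eq_succ_iff.1 h2; simp [h1, h2, this]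
    · have : ¬ prev? φ (c.eval (env φ i)) = some (r.eval (env φ i)) := fun h => h2 (prevCode_eq_succ_iff.2 h)
      simp [h1, h2, this]
/-- The `isSome` flag. [folklore] -/
theorem flag_isSome {c : AExp} (hc : c.eval (env φ i) < N φ) : (eIsSome c).flag (env φ i) = (prev? φ (c.eval (env φ i))).isSome := by
  rw [eIsSome, AExp.flag_lt, AExp.eval_lit, ev_prev hc]
  by_cases h : 0 < prevCode φ (c.eval (env φ i))
  · rw [prevCode_pos_iff.1 h]; simpa using h
  · have : (prev? φ (c.eval (env φ i))).isSome = false := by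
      cases hp : (prev? φ (c.eval (env φ i))).isSome
      · rfl
      · exact absurd (prevCode_pos_iff.2 hp) h
    rw [this]; simpa using h
/-- The `isNone` flag. [folklore] -/
theorem flag_isNone {c : AExp} (hc : c.eval (env φ i) < N φ) : (eIsNone c).flag (env φ i) = (prev? φ (c.eval (env φ i))).isNone := by
  rw [eIsNone, AExp.flag_beq, AExp.eval_lit, ev_prev hc]
  cases hp : prev? φ (c.eval (env φ i)) with
  | none => simp [prevCode, hp, optCode]
  | some r => simp [prevCode, hp, optCode]
/-- The polarity flag. [folklore] -/
theorem flag_pol (c : AExp) : (ePol c).flag (env φ i) = FormulaCells.polOf φ (c.eval (env φ i)) := by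
  unfold AExp.flag
  simp only [ePol, ev_tbl1, polsN_getD]
  cases FormulaCells.polOf φ (c.eval (env φ i)) <;> simp

end eval

end LOTProfile

end Literature.Barriers.CriticalPhenomena.GridSAW
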